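import Literature.NumberTheory.DiophantineGeometry.AbcWave0QualityFormProofs
import HarnessLib

/-!
# The uniform abc conjecture over number fields (abc.S21) contains abc over `ℚ`

`Literature.NumberTheory.DiophantineGeometry.UniformABCConjecture` (abc.S21 in
`Literature.NumberTheory.DiophantineGeometry.AbcWave0`) is Granville–Stark's *uniform
abc-conjecture for number fields*, eq. (1) of Invent. Math. 139 (2000), §1, raised to the power
`[K : ℚ]`: `H_K(a : b : c) < C ^ [K : ℚ] · (|D_K| · N_K(a, b, c)) ^ (1 + ε)` for all number fields
`K` at once. It is an OPEN conjecture and **not** a dischargeable named fact. This companion file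
proves, sorry-free and without touching any statement of `AbcWave0`, the folklore remark that
pins this down inside `Literature/` (which cannot import the summit `ABC` of
`Summits/ABC/ABC/Statement.lean`): *for `K = ℚ`, eq. (1) "is Oesterlé and Masser's
abc-conjecture"* (Granville–Stark, loc. cit., first paragraph of §1; Evertse–Győry, *Unit
Equations in Diophantine Number Theory* (2015), §4.6, after (4.6.5): "For `K = ℚ`, this reduces
to the Oesterlé–Masser Conjecture"; Táfula, Acta Arith. 201 (2021), §5.1, Remark after
Conjecture 5.1: "For `a, b, c ∈ ℤ` coprime, we have `ht(a:b:c) = log max{|a|,|b|,|c|}` and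
`𝒩(a:b:c) = log (∏_{p ∣ abc} p)`, recovering the abc-conjecture for `ℚ`").

* `UniformABCConjecture.mulHeight_natCast_eq` — for an abc triple `(a, b, c)` (coprime positive
  naturals, `a + b = c`) the relative height over `ℚ` is `H_ℚ(a : b : c) = c`
  (Mathlib's `Rat.mulHeight_eq_max_abs_of_gcd_eq_one`);
* `UniformABCConjecture.asIdeal_eq_span_natGenerator`, `….absNorm_asIdeal_eq_natGenerator` — a
  finite place `v` of `ℚ` (a `HeightOneSpectrum (𝓞 ℚ)`) is the ideal `(p)` of the prime
  `p = Rat.HeightOneSpectrum.natGenerator v`, of absolute norm `p`;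
* `UniformABCConjecture.radicalNorm_natCast_dvd_rad` — Granville–Stark's conductor of a triple of
  naturals divides the radical: `N_ℚ(a, b, c) ∣ rad(abc)` (a bad prime of `(a : b : c)` divides
  `abc`, and distinct places have distinct primes); for an abc triple equality holds,
  `UniformABCConjecture.radicalNorm_natCast_eq_rad : N_ℚ(a, b, c) = rad(abc)` (the remark "for
  `K = ℚ` and coprime integers this is `rad(abc)`" in the docstring of `radicalNorm`);
* `UniformABCConjecture.abc_rat` — **`UniformABCConjecture` implies, word for word, the displayed
  sentence of the summit statement `ABC`**:
  `∀ ε > 0, ∃ C > 0, ∀ abc triples, c < C · rad(abc) ^ (1 + ε)` (take `K = ℚ`: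
  `[ℚ : ℚ] = 1`, `D_ℚ = 1`, `H_ℚ = c`, `N_ℚ ≤ rad`); hence
  `UniformABCConjecture.not_abcNegation : ¬ ABCNegation` and
  `UniformABCConjecture.abcQualityForm : ABCQualityForm` via the equivalences of
  `AbcWave0QualityFormProofs`.

Consequently a `theorem UniformABCConjecture_holds` would be a proof of the abc conjecture (open;
the IUT claim is disputed, `Literature.Barriers.ABC.IUTDisputedClaim`) — and, by Granville–Stark's
Theorem 2 (`granville_stark_noSiegelZeros`, barrier record
`Literature.Barriers.ABC.UniformABCImpliesNoSiegelZeros`), a proof that `L(s, χ_{-d})` has no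
Siegel zeros. The fact therefore stays an explicit hypothesis `(h : UniformABCConjecture)`.

## References

* A. Granville, H. M. Stark, *ABC implies no "Siegel zeros" for `L`-functions of characters with
  negative discriminant*, Invent. Math. 139 (2000) 509–523, §1 eq. (1).
* J.-H. Evertse, K. Győry, *Unit Equations in Diophantine Number Theory*, CUP 2015, §4.6.
* P. Vojta, *Diophantine Approximations and Value Distribution Theory*, LNM 1239 (1987),
  Appendix ABC (p. 84).
* C. Táfula, *On Landau–Siegel zeros and heights of singular moduli*, Acta Arith. 201 (2021)
  (arXiv:1911.07215), §5.1.
-/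

noncomputable section

open UniqueFactorizationMonoid NumberField IsDedekindDomain

namespace Literature.NumberTheory.DiophantineGeometry

namespace UniformABCConjecture

/-! ### Finite places of `ℚ`: the place `v` is the ideal `(p)`, `p = natGenerator v` -/

/-- A natural number `n` lies in the finite place `v` of `ℚ` iff the prime
`p = Rat.HeightOneSpectrum.natGenerator v` under `v` divides `n`. [folklore] -/
theorem natCast_mem_asIdeal_iff (v : HeightOneSpectrum (𝓞 ℚ)) (n : ℕ) :
    (n : 𝓞 ℚ) ∈ v.asIdeal ↔ Rat.HeightOneSpectrum.natGenerator v ∣ n := by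
  rw [Rat.HeightOneSpectrum.natGenerator_dvd_iff,
    ← map_natCast (Rat.IsIntegralClosure.intEquiv (𝓞 ℚ)) n, Ideal.apply_mem_of_equiv_iff]

/-- The `v`-adic valuation of a natural number `n` is `1` iff the prime under `v` does not
divide `n`. [folklore] -/
theorem valuation_natCast_eq_one_iff (v : HeightOneSpectrum (𝓞 ℚ)) (n : ℕ) :
    v.valuation ℚ (n : ℚ) = 1 ↔ ¬ Rat.HeightOneSpectrum.natGenerator v ∣ n := by
  rw [← natCast_mem_asIdeal_iff, ← HeightOneSpectrum.valuation_eq_one_iff_notMem (K := ℚ),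
    map_natCast (algebraMap (𝓞 ℚ) ℚ) n]

/-- A finite place of `ℚ` is the principal ideal generated by the prime under it:
`v = (p)`, `p = Rat.HeightOneSpectrum.natGenerator v` (transport of
`Rat.HeightOneSpectrum.span_natGenerator` along `𝓞 ℚ ≃+* ℤ`). [folklore] -/
theorem asIdeal_eq_span_natGenerator (v : HeightOneSpectrum (𝓞 ℚ)) :
    v.asIdeal = Ideal.span {(Rat.HeightOneSpectrum.natGenerator v : 𝓞 ℚ)} := by
  ext x
  rw [Ideal.mem_span_singleton]
  constructor
  · intro hx
    have hx' : Rat.IsIntegralClosure.intEquiv (𝓞 ℚ) x ∈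
        v.asIdeal.map (Rat.IsIntegralClosure.intEquiv (𝓞 ℚ)) := Ideal.mem_map_of_mem _ hx
    rw [← Rat.HeightOneSpectrum.span_natGenerator, Ideal.mem_span_singleton] at hx'
    have h2 := map_dvd (Rat.IsIntegralClosure.intEquiv (𝓞 ℚ)).symm hx'
    rwa [map_natCast, RingEquiv.symm_apply_apply] at h2
  · rintro ⟨k, rfl⟩
    exact Ideal.mul_mem_right k _ ((natCast_mem_asIdeal_iff v _).2 dvd_rfl)

/-- Distinct finite places of `ℚ` lie over distinct primes. [folklore] -/
theorem natGenerator_injective :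
    Function.Injective (Rat.HeightOneSpectrum.natGenerator (R := 𝓞 ℚ)) := fun v w h =>
  HeightOneSpectrum.ext (by rw [asIdeal_eq_span_natGenerator v, asIdeal_eq_span_natGenerator w, h])

/-- The absolute norm of a finite place of `ℚ` is the prime under it: `N(v) = p`. [folklore] -/
theorem absNorm_asIdeal_eq_natGenerator (v : HeightOneSpectrum (𝓞 ℚ)) :
    Ideal.absNorm v.asIdeal = Rat.HeightOneSpectrum.natGenerator v := by
  rw [asIdeal_eq_span_natGenerator v, Ideal.absNorm_span_natCast, RingOfIntegers.rank,
    Module.finrank_self, pow_one]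

/-! ### The conductor of a triple of naturals divides the radical -/

/-- A bad prime of the projective point `(a : b : c)`, `a, b, c ∈ ℕ` — a finite place at which
the valuations of `a, b, c` are not all equal — lies over a prime factor of `abc`. [folklore] -/
theorem natGenerator_dvd_of_mem_badPrimes {a b c : ℕ} {v : HeightOneSpectrum (𝓞 ℚ)}
    (hv : v ∈ badPrimes (a : ℚ) (b : ℚ) (c : ℚ)) :
    Rat.HeightOneSpectrum.natGenerator v ∣ a * b * c := by
  by_contra h
  have ha : ¬ Rat.HeightOneSpectrum.natGenerator v ∣ a := fun h' => h ((h'.mul_right b).mul_right c)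
  have hb : ¬ Rat.HeightOneSpectrum.natGenerator v ∣ b := fun h' => h ((h'.mul_left a).mul_right c)
  have hc : ¬ Rat.HeightOneSpectrum.natGenerator v ∣ c := fun h' => h (h'.mul_left (a * b))
  refine hv ⟨?_, ?_⟩
  · rw [(valuation_natCast_eq_one_iff v a).2 ha, (valuation_natCast_eq_one_iff v b).2 hb]
  · rw [(valuation_natCast_eq_one_iff v b).2 hb, (valuation_natCast_eq_one_iff v c).2 hc]

/-- The set of bad primes of a triple of naturals with `abc ≠ 0` is finite (it injects into the
prime factors of `abc`). [folklore] -/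
theorem badPrimes_natCast_finite {a b c : ℕ} (habc : a * b * c ≠ 0) :
    (badPrimes (a : ℚ) (b : ℚ) (c : ℚ)).Finite := by
  refine Set.Finite.of_finite_image ((a * b * c).primeFactors.finite_toSet.subset ?_)
    (natGenerator_injective.injOn)
  rintro _ ⟨v, hv, rfl⟩
  exact Nat.mem_primeFactors.2
    ⟨Rat.HeightOneSpectrum.prime_natGenerator v, natGenerator_dvd_of_mem_badPrimes hv, habc⟩

/-- **`N_ℚ(a, b, c) ∣ rad(abc)`.** Granville–Stark's conductor (`radicalNorm`, the product of the
norms of the bad primes) of a triple of naturals with `abc ≠ 0` divides the radical of `abc`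
computed in `ℕ` (for coprime `a + b = c` the two are in fact equal; only the divisibility is
needed here). [cite: GranvilleStark2000, §1 eq. (1)] -/
theorem radicalNorm_natCast_dvd_rad {a b c : ℕ} (habc : a * b * c ≠ 0) :
    radicalNorm (a : ℚ) (b : ℚ) (c : ℚ) ∣ rad a b c := by
  classical
  have hfin := badPrimes_natCast_finite habc
  have himg : hfin.toFinset.image (Rat.HeightOneSpectrum.natGenerator (R := 𝓞 ℚ)) ⊆
      (a * b * c).primeFactors := by
    intro p hp
    obtain ⟨v, hv, rfl⟩ := Finset.mem_image.1 hp
    exact Nat.mem_primeFactors.2 ⟨Rat.HeightOneSpectrum.prime_natGenerator v,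
      natGenerator_dvd_of_mem_badPrimes (hfin.mem_toFinset.1 hv), habc⟩
  have key : ∏ v ∈ hfin.toFinset, Ideal.absNorm v.asIdeal =
      ∏ p ∈ hfin.toFinset.image (Rat.HeightOneSpectrum.natGenerator (R := 𝓞 ℚ)), p := by
    rw [Finset.prod_image fun v _ w _ h => natGenerator_injective h]
    exact Finset.prod_congr rfl fun v _ => absNorm_asIdeal_eq_natGenerator v
  unfold radicalNorm
  rw [finprod_mem_eq_finite_toFinset_prod _ hfin, key, rad_def, Nat.radical_eq_prod_primeFactors]
  exact Finset.prod_dvd_prod_of_subset _ _ _ himg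

/-- `N_ℚ(a, b, c) ≤ rad(abc)` for naturals with `abc ≠ 0`. [cite: GranvilleStark2000, §1 eq. (1)] -/
theorem radicalNorm_natCast_le_rad {a b c : ℕ} (habc : a * b * c ≠ 0) :
    radicalNorm (a : ℚ) (b : ℚ) (c : ℚ) ≤ rad a b c :=
  Nat.le_of_dvd (by rw [rad_def]; exact Nat.radical_pos _) (radicalNorm_natCast_dvd_rad habc)

/-- For an abc triple, conversely, every prime factor `p` of `abc` lies under a bad prime of
`(a : b : c)`: `p` divides exactly one of the pairwise coprime `a, b, c = a + b`, so the three
valuations at the place over `p` are not all equal. [folklore] -/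
theorem mem_badPrimes_of_natGenerator_dvd {a b c : ℕ} (h : IsABCTriple a b c)
    {v : HeightOneSpectrum (𝓞 ℚ)} (hv : Rat.HeightOneSpectrum.natGenerator v ∣ a * b * c) :
    v ∈ badPrimes (a : ℚ) (b : ℚ) (c : ℚ) := by
  obtain ⟨-, -, habc, hcop⟩ := h
  have hp := Rat.HeightOneSpectrum.prime_natGenerator v
  have e1 := valuation_natCast_eq_one_iff v a
  have e2 := valuation_natCast_eq_one_iff v b
  have e3 := valuation_natCast_eq_one_iff v c
  rintro ⟨h1, h2⟩
  rcases hp.dvd_mul.1 hv with hab | hc'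
  · rcases hp.dvd_mul.1 hab with ha' | hb'
    · have hnb : ¬ Rat.HeightOneSpectrum.natGenerator v ∣ b := fun hb' =>
        hp.one_lt.ne' (Nat.eq_one_of_dvd_coprimes hcop ha' hb')
      exact e1.1 (h1.trans (e2.2 hnb)) ha'
    · have hna : ¬ Rat.HeightOneSpectrum.natGenerator v ∣ a := fun ha' =>
        hp.one_lt.ne' (Nat.eq_one_of_dvd_coprimes hcop ha' hb')
      exact e2.1 (h1.symm.trans (e1.2 hna)) hb'
  · have hnb : ¬ Rat.HeightOneSpectrum.natGenerator v ∣ b := fun hb' => by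
      refine hp.one_lt.ne' (Nat.eq_one_of_dvd_coprimes hcop ?_ hb')
      have := Nat.dvd_sub hc' hb'
      rwa [show c - b = a by omega] at this
    exact e3.1 (h2.symm.trans (e2.2 hnb)) hc'

/-- **`N_ℚ(a, b, c) = rad(abc)`** for an abc triple — the remark "For `K = ℚ` and coprime
integers this is `rad(abc)`" of the docstring of `radicalNorm`, now a theorem: the bad primes of
`(a : b : c)` are exactly the places over the prime factors of `abc`, each of norm `p`.
[cite: GranvilleStark2000, §1 eq. (1)] -/
theorem radicalNorm_natCast_eq_rad {a b c : ℕ} (h : IsABCTriple a b c) :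
    radicalNorm (a : ℚ) (b : ℚ) (c : ℚ) = rad a b c := by
  classical
  have ha : 0 < a := h.1
  have hb : 0 < b := h.2.1
  have hc : 0 < c := by have := h.2.2.1; omega
  have habc : a * b * c ≠ 0 := by positivity
  have hfin := badPrimes_natCast_finite habc
  have himg : hfin.toFinset.image (Rat.HeightOneSpectrum.natGenerator (R := 𝓞 ℚ)) =
      (a * b * c).primeFactors := by
    ext p
    rw [Finset.mem_image, Nat.mem_primeFactors_of_ne_zero habc]
    constructor
    · rintro ⟨v, hv, rfl⟩
      exact ⟨Rat.HeightOneSpectrum.prime_natGenerator v,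
        natGenerator_dvd_of_mem_badPrimes (hfin.mem_toFinset.1 hv)⟩
    · rintro ⟨hp, hdvd⟩
      have key : Rat.HeightOneSpectrum.natGenerator
          ((Rat.HeightOneSpectrum.primesEquiv (R := 𝓞 ℚ)).symm ⟨p, hp⟩) = p :=
        congrArg Subtype.val ((Rat.HeightOneSpectrum.primesEquiv (R := 𝓞 ℚ)).apply_symm_apply ⟨p, hp⟩)
      refine ⟨(Rat.HeightOneSpectrum.primesEquiv (R := 𝓞 ℚ)).symm ⟨p, hp⟩, ?_, key⟩
      exact hfin.mem_toFinset.2 (mem_badPrimes_of_natGenerator_dvd h (by rw [key]; exact hdvd))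
  unfold radicalNorm
  rw [finprod_mem_eq_finite_toFinset_prod _ hfin, rad_def, Nat.radical_eq_prod_primeFactors, ← himg,
    Finset.prod_image fun v _ w _ h => natGenerator_injective h]
  exact Finset.prod_congr rfl fun v _ => absNorm_asIdeal_eq_natGenerator v

/-! ### The height of an abc triple over `ℚ` -/

/-- **`H_ℚ(a : b : c) = c`** for an abc triple: Mathlib's relative multiplicative height over `ℚ`
of a tuple of coprime integers is the maximum of their absolute values
(`Rat.mulHeight_eq_max_abs_of_gcd_eq_one`), and `max(a, b, a + b) = a + b = c`.
[cite: GranvilleStark2000, §1] -/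
theorem mulHeight_natCast_eq {a b c : ℕ} (h : IsABCTriple a b c) :
    Height.mulHeight ![(a : ℚ), (b : ℚ), (c : ℚ)] = c := by
  obtain ⟨-, -, habc, hcop⟩ := h
  have hx : ![(a : ℚ), (b : ℚ), (c : ℚ)] = ((↑) : ℤ → ℚ) ∘ ![(a : ℤ), (b : ℤ), (c : ℤ)] := by
    ext i
    fin_cases i <;> simp
  have h0 : Finset.univ.gcd ![(a : ℤ), (b : ℤ), (c : ℤ)] ∣ (a : ℤ) :=
    Finset.gcd_dvd (Finset.mem_univ (0 : Fin 3))
  have h1 : Finset.univ.gcd ![(a : ℤ), (b : ℤ), (c : ℤ)] ∣ (b : ℤ) :=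
    Finset.gcd_dvd (Finset.mem_univ (1 : Fin 3))
  have hgcd : Finset.univ.gcd ![(a : ℤ), (b : ℤ), (c : ℤ)] = 1 := by
    rw [← Finset.normalize_gcd]
    exact normalize_eq_one.2 ((Nat.isCoprime_iff_coprime.2 hcop).isUnit_of_dvd' h0 h1)
  have key : (⨆ i, |![(a : ℤ), (b : ℤ), (c : ℤ)] i|) = (c : ℤ) :=
    le_antisymm (ciSup_le fun i => by fin_cases i <;> simp <;> omega)
      (le_ciSup_of_le (Finite.bddAbove_range _) 2 (by simp))
  rw [hx, Rat.mulHeight_eq_max_abs_of_gcd_eq_one hgcd]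
  exact_mod_cast key

/-! ### `K = ℚ`: the uniform conjecture contains the abc conjecture -/

/-- **Uniform abc over number fields implies abc over `ℚ`** — the displayed sentence of the
summit statement `ABC` (`Summits/ABC/ABC/Statement.lean`: `∀ ε > 0, ∃ C > 0`, every abc triple
has `c < C · rad(abc) ^ (1 + ε)`), obtained from `UniformABCConjecture` at `K = ℚ`: there
`[ℚ : ℚ] = 1`, `D_ℚ = 1` (`Rat.numberField_discr`), `H_ℚ(a : b : c) = c`
(`mulHeight_natCast_eq`) and `N_ℚ(a, b, c) ≤ rad(abc)` (`radicalNorm_natCast_le_rad`); the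
constant `C` of the conjecture is replaced by `max C 1 > 0`. "Oesterlé and Masser's
abc-conjecture asserts that … `c ≪_ε N(a, b, c)^{1+ε}`" is the case `K = ℚ` of eq. (1)
[cite: GranvilleStark2000, §1 eq. (1)]; "For `K = ℚ`, this reduces to the Oesterlé–Masser
Conjecture" [cite: EvertseGyory2015, §4.6 eq. (4.6.5)]. Since abc is open, this theorem is why
there is no `UniformABCConjecture_holds`. -/
theorem abc_rat (h : UniformABCConjecture) :
    ∀ ε : ℝ, 0 < ε → ∃ C : ℝ, 0 < C ∧
      ∀ a b c : ℕ, IsABCTriple a b c → (c : ℝ) < C * ((rad a b c : ℕ) : ℝ) ^ (1 + ε) := by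
  intro ε hε
  obtain ⟨C, hC⟩ := h ε hε
  refine ⟨max C 1, lt_max_of_lt_right one_pos, fun a b c ht => ?_⟩
  have ha : 0 < a := ht.1
  have hb : 0 < b := ht.2.1
  have hc : 0 < c := by have := ht.2.2.1; omega
  have habc : a * b * c ≠ 0 := by positivity
  have H := hC ℚ (a : ℚ) (b : ℚ) (c : ℚ) (by exact_mod_cast ha.ne') (by exact_mod_cast hb.ne')
    (by exact_mod_cast hc.ne') (by exact_mod_cast ht.2.2.1)
  have H' : (c : ℝ) < C ^ Module.finrank ℚ ℚ *
      ((|NumberField.discr ℚ| : ℝ) * (radicalNorm (a : ℚ) (b : ℚ) (c : ℚ) : ℝ)) ^ (1 + ε) :=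
    lt_of_eq_of_lt (mulHeight_natCast_eq ht).symm H
  simp only [Module.finrank_self, pow_one, Rat.numberField_discr, Int.cast_one, abs_one,
    one_mul] at H'
  have hN : (radicalNorm (a : ℚ) (b : ℚ) (c : ℚ) : ℝ) ≤ ((rad a b c : ℕ) : ℝ) := by
    exact_mod_cast radicalNorm_natCast_le_rad habc
  have hpow : (radicalNorm (a : ℚ) (b : ℚ) (c : ℚ) : ℝ) ^ (1 + ε) ≤
      ((rad a b c : ℕ) : ℝ) ^ (1 + ε) :=
    Real.rpow_le_rpow (Nat.cast_nonneg _) hN (by linarith)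
  calc (c : ℝ) < C * (radicalNorm (a : ℚ) (b : ℚ) (c : ℚ) : ℝ) ^ (1 + ε) := H'
    _ ≤ max C 1 * (radicalNorm (a : ℚ) (b : ℚ) (c : ℚ) : ℝ) ^ (1 + ε) :=
      mul_le_mul_of_nonneg_right (le_max_left C 1) (by positivity)
    _ ≤ max C 1 * ((rad a b c : ℕ) : ℝ) ^ (1 + ε) :=
      mul_le_mul_of_nonneg_left hpow (by positivity)

/-- **Uniform abc over number fields refutes the abc-neg flag**: `UniformABCConjecture → ¬ ABCNegation`
(abc.S02), via `abc_rat` and `not_abcNegation_iff_forall_exists_const`.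
[cite: GranvilleStark2000, §1 eq. (1)] -/
theorem not_abcNegation (h : UniformABCConjecture) : ¬ ABCNegation :=
  not_abcNegation_iff_forall_exists_const.2 (abc_rat h)

/-- **Uniform abc over number fields implies the quality form of abc** (abc.S05, "for every
`ε > 0` only finitely many abc triples have quality `> 1 + ε`"), via `abc_rat` and
`abcQualityForm_iff_forall_exists_const`. [cite: GranvilleStark2000, §1 eq. (1)] -/
theorem abcQualityForm (h : UniformABCConjecture) : ABCQualityForm :=
  abcQualityForm_iff_forall_exists_const.2 (abc_rat h)

end UniformABCConjecture

end Literature.NumberTheory.DiophantineGeometry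

end
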